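import Literature.NumberTheory.GaloisRepresentations.PinnedDatumLabels
import Literature.NumberTheory.GaloisRepresentations.PadicEmbeddingCompletion
import HarnessLib

/-!
# The labels of an extension `E/K` above a label `(v, τ)` of `K`

Topic `NumberTheory/GaloisRepresentations`; theorems only (no definition, no named fact), in the
vocabulary of `PinnedDatumLabels` (`PinnedLabel ℓ v hv`, `PinnedLabel.emb`, rigidity
`PinnedLabel.place_eq` / `eq_of_emb_eq`) and `PadicEmbeddingCompletion` (`PadicEmbedding.place`,
`PadicEmbedding.lift`: every `ℓ`-adic embedding of a number field factors continuously through the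
completion at its place).

* `PinnedLabel.exists_emb_eq` — **every embedding `φ : K → ℚ̄_ℓ` is the global embedding of a label**,
  at the place `v_φ` of `φ` (`PadicEmbedding.place φ`): the label `φ̂ = PadicEmbedding.lift φ`;
  `PinnedLabel.place_emb` — conversely the place of `τ.emb` is the place of `τ`.  Together with the
  rigidity theorems of `PinnedDatumLabels` this is the bijection "labels of `K` above `ℓ` ↔
  embeddings `K → ℚ̄_ℓ`" (Serre, *Abelian ℓ-adic representations*, Ch. II §3.1; Neukirch, ANT,
  Ch. II (8.1)–(8.3)).
* `PinnedLabel.exists_labels_above` — for number fields `K ⊆ E` with `[E : K] = d` and a label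
  `(v, τ)` of `K` above `ℓ`: **there are `d` labels `(w_i, σ_i)` of `E` above `(v, τ)`**
  (`σ_i.emb ∘ (K → E) = τ.emb`) with pairwise distinct global embeddings, every `w_i` lying over `v`,
  and they are ALL the labels of `E` above `(v, τ)` (every label `σ'` of `E` with
  `σ'.emb ∘ (K → E) = τ.emb` has the global embedding, hence the place and the label, of some
  `σ_i`) — the `d` extensions `E → ℚ̄_ℓ` of `τ.emb` (Mathlib `AlgHom.card`: `E/K` is separable of
  degree `d` and `ℚ̄_ℓ` is algebraically closed).  This is the indexing set of Patrikis' formula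
  `HT_{(v,τ)}(Ind_E^K W) = Σ_i HT_{(w_i,σ_i)}(W)` (Lemma 7.2.1), i.e. the first two clauses of the
  tree's named fact `PAdicHodge.LabelledWeightsInduceSchema`.

## References

* [SerreAbelianLadic1968] J.-P. Serre, *Abelian ℓ-adic representations and elliptic curves* (1968),
  Ch. II §3.1 (embeddings `K → ℚ̄_ℓ` and places above `ℓ`).
* [NeukirchANT1999] J. Neukirch, *Algebraic Number Theory* (1999), Ch. II (8.1)–(8.3) (extensions of
  valuations ↔ embeddings of completions; `Σ_{w ∣ v} [E_w : K_v] = [E : K]`).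
* [Patrikis2019] S. Patrikis, *Variations on a theorem of Tate*, Mem. AMS 258 (2019), §2.7.1 and
  Lemma 7.2.1 (labelled weights indexed by `τ : F ↪ ℚ̄_ℓ`; induction).
-/

noncomputable section

open scoped NumberField
open NumberField IsDedekindDomain

namespace Literature.NumberTheory.GaloisRepresentations

namespace PinnedLabel

variable {K : Type} [Field K] [NumberField K] {ℓ : ℕ} [Fact ℓ.Prime]

/-! ### Labels ↔ embeddings -/

/-- The global embedding of the label `ofContinuous v hv τ₀ h` is `τ₀ ∘ (K → K_v)`. [folklore] -/
private theorem emb_ofContinuous {v : HeightOneSpectrum (𝓞 K)} {hv : ((ℓ : ℕ) : 𝓞 K) ∈ v.asIdeal}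
    (τ₀ : v.adicCompletion K →+* PadicAlgCl ℓ) (h : Continuous τ₀) :
    (ofContinuous v hv τ₀ h).emb = τ₀.comp (algebraMap K (v.adicCompletion K)) := by
  rw [emb, toHom_ofContinuous]

/-- **Every `ℓ`-adic embedding `φ : K → ℚ̄_ℓ` is the global embedding of a label of `K`**, namely of
the continuous extension `φ̂ : K_{v_φ} → ℚ̄_ℓ` of `φ` at the place `v_φ ∣ ℓ` of `φ`
(`PadicEmbedding.lift`, `PadicEmbedding.place`).
[cite: SerreAbelianLadic1968, Ch. II §3.1] [cite: NeukirchANT1999, Ch. II Thm. (8.1)] -/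
theorem exists_emb_eq (φ : K →+* PadicAlgCl ℓ) :
    ∃ τ : PinnedLabel ℓ (PadicEmbedding.place φ) (PadicEmbedding.natCast_mem_place φ), τ.emb = φ :=
  ⟨ofContinuous _ _ (PadicEmbedding.lift φ) (PadicEmbedding.continuous_lift φ),
    by
      rw [emb_ofContinuous]
      exact RingHom.ext fun a => PadicEmbedding.lift_algebraMap φ a⟩

/-- Every `ℓ`-adic embedding `φ : K → ℚ̄_ℓ` is the global embedding of some label `(v, τ)` of `K`
above `ℓ`. [cite: SerreAbelianLadic1968, Ch. II §3.1] -/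
theorem exists_label_emb_eq (φ : K →+* PadicAlgCl ℓ) :
    ∃ (v : HeightOneSpectrum (𝓞 K)) (hv : ((ℓ : ℕ) : 𝓞 K) ∈ v.asIdeal) (τ : PinnedLabel ℓ v hv),
      τ.emb = φ :=
  ⟨_, _, exists_emb_eq φ⟩

/-- **The place of the global embedding of a label is the place of the label**
(`PadicEmbedding.place_comp_algebraMap`; labels are continuous). [cite: SerreAbelianLadic1968, Ch. II §3.1] -/
theorem place_emb {v : HeightOneSpectrum (𝓞 K)} {hv : ((ℓ : ℕ) : 𝓞 K) ∈ v.asIdeal}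
    (τ : PinnedLabel ℓ v hv) : PadicEmbedding.place τ.emb = v := by
  rw [emb]
  exact PadicEmbedding.place_comp_algebraMap τ.toHom τ.continuous

/-- Hence a label `(v', τ')` whose global embedding is `φ` sits at the place of `φ`, and is the label
`exists_emb_eq` produces there (rigidity). [cite: SerreAbelianLadic1968, Ch. II §3.1] -/
theorem place_eq_place_of_emb_eq {v : HeightOneSpectrum (𝓞 K)} {hv : ((ℓ : ℕ) : 𝓞 K) ∈ v.asIdeal}
    (τ : PinnedLabel ℓ v hv) {φ : K →+* PadicAlgCl ℓ} (h : τ.emb = φ) :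
    v = PadicEmbedding.place φ := by
  rw [← h, place_emb]

/-! ### Places and integers along `K ⊆ E` -/

section Relative

variable {E : Type} [Field E] [NumberField E] [Algebra K E]

/-- The place of the restriction `φ ∘ (K → E)` of an embedding `φ : E → ℚ̄_ℓ` lies under the place
of `φ`: `𝔭_{φ ∘ (K → E)} = 𝔭_φ ∩ 𝓞 K`. [cite: NeukirchANT1999, Ch. II (8.1)–(8.2)] -/
theorem _root_.Literature.NumberTheory.GaloisRepresentations.PadicEmbedding.place_comp_asIdeal
    (φ : E →+* PadicAlgCl ℓ) :
    (PadicEmbedding.place (φ.comp (algebraMap K E))).asIdeal =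
      (PadicEmbedding.place φ).asIdeal.comap (algebraMap (𝓞 K) (𝓞 E)) := by
  ext d
  rw [Ideal.mem_comap]
  change d ∈ PadicEmbedding.ideal _ ↔ algebraMap (𝓞 K) (𝓞 E) d ∈ PadicEmbedding.ideal φ
  rw [PadicEmbedding.mem_ideal_iff, PadicEmbedding.mem_ideal_iff, RingHom.comp_apply]
  rfl

/-- Hence the place of `φ` LIES OVER the place of `φ ∘ (K → E)`. [cite: NeukirchANT1999, Ch. II (8.1)–(8.2)] -/
theorem _root_.Literature.NumberTheory.GaloisRepresentations.PadicEmbedding.place_liesOver_place_comp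
    (φ : E →+* PadicAlgCl ℓ) :
    (PadicEmbedding.place φ).asIdeal.LiesOver (PadicEmbedding.place (φ.comp (algebraMap K E))).asIdeal :=
  ⟨PadicEmbedding.place_comp_asIdeal φ⟩

/-- A label `(w, σ)` of `E` above the label `(v, τ)` of `K` (`σ.emb ∘ (K → E) = τ.emb`) sits at a place
`w` over `v`. [cite: NeukirchANT1999, Ch. II (8.1)–(8.2)] -/
theorem liesOver_of_emb_comp_eq {v : HeightOneSpectrum (𝓞 K)} {hv : ((ℓ : ℕ) : 𝓞 K) ∈ v.asIdeal}
    (τ : PinnedLabel ℓ v hv) {w : HeightOneSpectrum (𝓞 E)} {hw : ((ℓ : ℕ) : 𝓞 E) ∈ w.asIdeal}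
    (σ : PinnedLabel ℓ w hw) (h : σ.emb.comp (algebraMap K E) = τ.emb) :
    w.asIdeal.LiesOver v.asIdeal := by
  have hw' : w = PadicEmbedding.place σ.emb := (place_emb σ).symm
  have hv' : v = PadicEmbedding.place (σ.emb.comp (algebraMap K E)) := by rw [h, place_emb]
  rw [hw', hv']
  exact PadicEmbedding.place_liesOver_place_comp σ.emb

/-! ### The `d` labels of `E` above a label of `K` -/

/-- **The labels of `E` above a label `(v, τ)` of `K`.**  For number fields `K ⊆ E` with
`[E : K] = d` and a label `(v, τ)` of `K` above `ℓ` there are `d` labels `(w_i, σ_i)` of `E` with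
`σ_i.emb ∘ (K → E) = τ.emb`, pairwise distinct global embeddings `σ_i.emb : E → ℚ̄_ℓ`, every `w_i`
lying over `v`; and every label `(w', σ')` of `E` above `(v, τ)` has the global embedding of one of
them (so, by rigidity `PinnedLabel.place_eq` / `eq_of_emb_eq`, IS one of them).  The `σ_i.emb` are the
`d = [E : K]` extensions of `τ.emb` to `E` (Mathlib `AlgHom.card`), localised by `exists_emb_eq`.
[cite: NeukirchANT1999, Ch. II (8.1)–(8.3)] [cite: Patrikis2019, §2.7.1 and Lemma 7.2.1]
[cite: SerreAbelianLadic1968, Ch. II §3.1] -/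
theorem exists_labels_above {d : ℕ} (hd : Module.finrank K E = d)
    {v : HeightOneSpectrum (𝓞 K)} {hv : ((ℓ : ℕ) : 𝓞 K) ∈ v.asIdeal} (τ : PinnedLabel ℓ v hv) :
    ∃ (w : Fin d → HeightOneSpectrum (𝓞 E)) (hw : ∀ i, ((ℓ : ℕ) : 𝓞 E) ∈ (w i).asIdeal)
      (σ : ∀ i, PinnedLabel ℓ (w i) (hw i)),
      (∀ i, (σ i).emb.comp (algebraMap K E) = τ.emb) ∧
      (Function.Injective fun i => (σ i).emb) ∧
      (∀ i, (w i).asIdeal.LiesOver v.asIdeal) ∧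
      ∀ (w' : HeightOneSpectrum (𝓞 E)) (hw' : ((ℓ : ℕ) : 𝓞 E) ∈ w'.asIdeal) (σ' : PinnedLabel ℓ w' hw'),
        σ'.emb.comp (algebraMap K E) = τ.emb → ∃ i, (σ i).emb = σ'.emb := by
  classical
  letI : Algebra K (PadicAlgCl ℓ) := τ.emb.toAlgebra
  haveI : FiniteDimensional K E := Module.Finite.of_restrictScalars_finite ℚ K E
  -- the `d` extensions of `τ.emb` to `E`
  have hcard : Fintype.card (E →ₐ[K] PadicAlgCl ℓ) = d := by rw [AlgHom.card, hd]
  let e : (E →ₐ[K] PadicAlgCl ℓ) ≃ Fin d := Fintype.equivFinOfCardEq hcard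
  let φ : Fin d → E →+* PadicAlgCl ℓ := fun i => (e.symm i : E →ₐ[K] PadicAlgCl ℓ).toRingHom
  have hφ : ∀ i, (φ i).comp (algebraMap K E) = τ.emb := fun i => (e.symm i).comp_algebraMap
  -- localise them
  choose σ hσ using fun i => exists_emb_eq (φ i)
  refine ⟨fun i => PadicEmbedding.place (φ i), fun i => PadicEmbedding.natCast_mem_place (φ i), σ,
    fun i => by rw [hσ]; exact hφ i, fun i j hij => ?_, fun i => ?_, fun w' hw' σ' hσ' => ?_⟩
  · -- distinct global embeddings
    have h : φ i = φ j := by rw [← hσ i, ← hσ j]; exact hij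
    have h' : e.symm i = e.symm j := AlgHom.coe_ringHom_injective h
    simpa using congrArg e h'
  · -- `w_i` lies over `v`
    exact liesOver_of_emb_comp_eq τ (σ i) (by rw [hσ]; exact hφ i)
  · -- completeness: `σ'.emb` is a `K`-algebra map `E → ℚ̄_ℓ`, hence one of the `φ i`
    let ψ : E →ₐ[K] PadicAlgCl ℓ :=
      { σ'.emb with
        commutes' := fun k => by
          change σ'.emb (algebraMap K E k) = τ.emb k
          rw [← RingHom.comp_apply, hσ'] }
    refine ⟨e ψ, ?_⟩
    rw [hσ]
    change ((e.symm (e ψ) : E →ₐ[K] PadicAlgCl ℓ) : E →+* PadicAlgCl ℓ) = σ'.emb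
    rw [Equiv.symm_apply_apply]
    rfl

/-- **Counting form**: the labels of `E` above `(v, τ)`, read through their global embeddings, are
in bijection with `Fin [E : K]` — the set of global embeddings `E → ℚ̄_ℓ` of labels of `E` extending
`τ.emb` is exactly `{σ_i.emb}` for the family of `exists_labels_above`; in particular two families
of labels above `(v, τ)` with pairwise distinct embeddings, both of size `[E : K]`, have the same
set of global embeddings. [cite: NeukirchANT1999, Ch. II (8.2)–(8.3)] -/
theorem range_emb_eq_of_labels_above {d : ℕ} (hd : Module.finrank K E = d)
    {v : HeightOneSpectrum (𝓞 K)} {hv : ((ℓ : ℕ) : 𝓞 K) ∈ v.asIdeal} (τ : PinnedLabel ℓ v hv)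
    {w₁ w₂ : Fin d → HeightOneSpectrum (𝓞 E)} {hw₁ : ∀ i, ((ℓ : ℕ) : 𝓞 E) ∈ (w₁ i).asIdeal}
    {hw₂ : ∀ i, ((ℓ : ℕ) : 𝓞 E) ∈ (w₂ i).asIdeal}
    (σ₁ : ∀ i, PinnedLabel ℓ (w₁ i) (hw₁ i)) (σ₂ : ∀ i, PinnedLabel ℓ (w₂ i) (hw₂ i))
    (h₁ : ∀ i, (σ₁ i).emb.comp (algebraMap K E) = τ.emb) (hinj₁ : Function.Injective fun i => (σ₁ i).emb)
    (h₂ : ∀ i, (σ₂ i).emb.comp (algebraMap K E) = τ.emb) (hinj₂ : Function.Injective fun i => (σ₂ i).emb) :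
    ∃ π : Equiv.Perm (Fin d), ∀ i, (σ₂ i).emb = (σ₁ (π i)).emb ∧ w₂ i = w₁ (π i) := by
  classical
  letI : Algebra K (PadicAlgCl ℓ) := τ.emb.toAlgebra
  haveI : FiniteDimensional K E := Module.Finite.of_restrictScalars_finite ℚ K E
  have hcard : Fintype.card (E →ₐ[K] PadicAlgCl ℓ) = d := by rw [AlgHom.card, hd]
  -- both families, read as `K`-algebra maps, are bijections `Fin d → (E →ₐ[K] ℚ̄_ℓ)`
  let toAlg : ∀ {w : HeightOneSpectrum (𝓞 E)} {hw : ((ℓ : ℕ) : 𝓞 E) ∈ w.asIdeal}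
      (σ : PinnedLabel ℓ w hw), σ.emb.comp (algebraMap K E) = τ.emb → (E →ₐ[K] PadicAlgCl ℓ) :=
    fun σ hσ =>
      { σ.emb with
        commutes' := fun k => by
          change σ.emb (algebraMap K E k) = τ.emb k
          rw [← RingHom.comp_apply, hσ] }
  have htoAlg : ∀ {w : HeightOneSpectrum (𝓞 E)} {hw : ((ℓ : ℕ) : 𝓞 E) ∈ w.asIdeal}
      (σ : PinnedLabel ℓ w hw) (hσ : σ.emb.comp (algebraMap K E) = τ.emb),
      ((toAlg σ hσ : E →ₐ[K] PadicAlgCl ℓ) : E →+* PadicAlgCl ℓ) = σ.emb := fun σ hσ => rfl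
  let f₁ : Fin d → (E →ₐ[K] PadicAlgCl ℓ) := fun i => toAlg (σ₁ i) (h₁ i)
  let f₂ : Fin d → (E →ₐ[K] PadicAlgCl ℓ) := fun i => toAlg (σ₂ i) (h₂ i)
  have hf₁ : Function.Injective f₁ := fun i j hij => hinj₁ (by
    change (σ₁ i).emb = (σ₁ j).emb
    rw [← htoAlg (σ₁ i) (h₁ i), ← htoAlg (σ₁ j) (h₁ j)]
    exact congrArg (fun g : E →ₐ[K] PadicAlgCl ℓ => (g : E →+* PadicAlgCl ℓ)) hij)
  have hbij₁ : Function.Bijective f₁ := by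
    refine (Fintype.bijective_iff_injective_and_card f₁).2 ⟨hf₁, ?_⟩
    rw [Fintype.card_fin, hcard]
  refine ⟨Equiv.ofBijective (fun i => (Equiv.ofBijective f₁ hbij₁).symm (f₂ i)) ?_, fun i => ?_⟩
  · -- a composition of an injection with a bijection on a finite type is a permutation
    have hf₂ : Function.Injective f₂ := fun i j hij => hinj₂ (by
      change (σ₂ i).emb = (σ₂ j).emb
      rw [← htoAlg (σ₂ i) (h₂ i), ← htoAlg (σ₂ j) (h₂ j)]
      exact congrArg (fun g : E →ₐ[K] PadicAlgCl ℓ => (g : E →+* PadicAlgCl ℓ)) hij)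
    have hinj : Function.Injective fun i => (Equiv.ofBijective f₁ hbij₁).symm (f₂ i) :=
      (Equiv.ofBijective f₁ hbij₁).symm.injective.comp hf₂
    exact (Fintype.bijective_iff_injective_and_card _).2 ⟨hinj, rfl⟩
  · have hπ : f₁ ((Equiv.ofBijective f₁ hbij₁).symm (f₂ i)) = f₂ i :=
      (Equiv.ofBijective f₁ hbij₁).apply_symm_apply (f₂ i)
    have hemb : (σ₂ i).emb = (σ₁ ((Equiv.ofBijective f₁ hbij₁).symm (f₂ i))).emb := by
      rw [← htoAlg (σ₂ i) (h₂ i), ← htoAlg (σ₁ _) (h₁ _)]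
      exact congrArg (fun g : E →ₐ[K] PadicAlgCl ℓ => (g : E →+* PadicAlgCl ℓ)) hπ.symm
    exact ⟨hemb, PinnedLabel.place_eq (σ₂ i) (σ₁ _) hemb⟩

end Relative

end PinnedLabel

end Literature.NumberTheory.GaloisRepresentations

end
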